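import Mathlib.RingTheory.AlgebraicIndependent.TranscendenceBasis
import Mathlib.RingTheory.Algebraic.Integral
import Mathlib.FieldTheory.IsAlgClosed.Basic
import Mathlib.FieldTheory.Minpoly.Field
import Mathlib.Data.Set.Card
import HarnessLib

/-!
# Bookkeeping for algebraic dependence over subalgebras `F[s]` of a field

`Literature/FieldTheory/TranscendenceDegree/AlgebraicDependenceBookkeeping.lean`
(namespace `Literature.FieldTheory.TranscendenceDegree`). Everything PROVED, no definition.
For a field extension `K / F` and the matroid of algebraic independence
(`AlgebraicIndependent.matroid F K`, whose closure of `s` is the set of elements algebraic over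
`F[s] = Algebra.adjoin F s`, Mathlib's `matroid_closure_eq`):

* `mem_closure_iff_isAlgebraic` — the dictionary `a ∈ cl s ↔ IsAlgebraic F[s] a`;
* `isAlgebraic_adjoin_singleton_of_aeval_eq_zero` — a non-trivial relation `P(a, b) = 0` with
  `a` transcendental makes `b` algebraic over `F[a]`;
* `exists_relation_of_isAlgebraic_pair` — two elements algebraic over `F[a]` satisfy a
  non-trivial polynomial relation over `F`;
* `isAlgebraic_exchange` — the exchange property: `b` algebraic over `F[a]` and transcendental
  over `F` implies `a` algebraic over `F[b]`;
* `isAlgebraic_adjoin_of_mem_closure_singleton` — transitivity `b ∈ cl{a}`, `a ∈ cl s ⇒ b ∈ cl s`;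
* `trdeg_le_card_of_forall_isAlgebraic` — `trdeg_F A ≤ #s` if every element of the
  subalgebra `A` is algebraic over `F[s]`;
* `mem_range_algebraMap_of_isAlgebraic` — over an algebraically closed `F`, algebraic elements
  of `K` are scalars.

[folklore]

## References

* S. Lang, *Algebra*, GTM 211, Ch. VIII §1 (transcendence bases, exchange). [folklore]
-/

noncomputable section

open Set Cardinal MvPolynomial

namespace Literature.FieldTheory.TranscendenceDegree

variable {F K : Type*} [Field F] [Field K] [Algebra F K]

-- `FaithfulSMul F K` for a field extension is Mathlib's global instance
-- `Module.Free.instFaithfulSMulOfNontrivial`; no local restatement is kept (dedup-01374).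

/-- **Dictionary**: membership in the matroid closure of `s` is algebraicity over `F[s]`.
[folklore] -/
theorem mem_closure_iff_isAlgebraic (s : Set K) (a : K) :
    a ∈ (AlgebraicIndependent.matroid F K).closure s ↔
      IsAlgebraic (Algebra.adjoin F s) a := by
  rw [AlgebraicIndependent.matroid_closure_eq]
  rfl

/-- **A relation with a transcendental element.** If `P(a, b) = 0` for a non-zero
`P ∈ F[X, Y]` and `a` is transcendental over `F`, then `b` is algebraic over `F[a]`. [folklore] -/
theorem isAlgebraic_adjoin_singleton_of_aeval_eq_zero {a b : K} {P : MvPolynomial (Fin 2) F}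
    (hP : P ≠ 0) (h : MvPolynomial.aeval ![a, b] P = 0) (ha : Transcendental F a) :
    IsAlgebraic (Algebra.adjoin F ({a} : Set K)) b := by
  classical
  -- the pair `(b ; a)` indexed by `Option (Fin 1)` is algebraically dependent
  have hdep : ¬ AlgebraicIndependent F (fun o : Option (Fin 1) => o.elim b ![a]) := by
    intro hind
    rw [algebraicIndependent_iff] at hind
    -- transport `P` along the reindexing `Fin 2 ≃ Option (Fin 1)`, `0 ↦ some 0`, `1 ↦ none`
    let e : Fin 2 → Option (Fin 1) := ![some 0, none]
    have he : Function.Injective e := by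
      intro i j hij; fin_cases i <;> fin_cases j <;> simp_all [e]
    have hval : ∀ i, (fun o : Option (Fin 1) => o.elim b ![a]) (e i) = ![a, b] i := by
      intro i; fin_cases i <;> rfl
    have h' : MvPolynomial.aeval (fun o : Option (Fin 1) => o.elim b ![a]) (rename e P) = 0 := by
      rw [MvPolynomial.aeval_rename]
      have : ((fun o : Option (Fin 1) => o.elim b ![a]) ∘ e) = ![a, b] := funext hval
      rw [this, h]
    have := hind _ h'
    exact hP (MvPolynomial.rename_injective e he (by rw [this, map_zero]))
  rw [AlgebraicIndependent.option_iff] at hdep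
  push Not at hdep
  have hind : AlgebraicIndependent F ![a] :=
    (algebraicIndependent_unique_type_iff (x := ![a])).2 ha
  have := hdep hind
  rw [Transcendental, not_not] at this
  have hrange : Set.range ![a] = {a} := by
    ext x; simp [Matrix.range_cons, Matrix.range_empty]
  rwa [hrange] at this

/-- **Two elements algebraic over `F[a]` are algebraically dependent over `F`**: there is a
non-zero `R ∈ F[X, Y]` with `R(b₁, b₂) = 0`. [folklore] -/
theorem exists_relation_of_isAlgebraic_pair {a b₁ b₂ : K}
    (h₁ : IsAlgebraic (Algebra.adjoin F ({a} : Set K)) b₁)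
    (h₂ : IsAlgebraic (Algebra.adjoin F ({a} : Set K)) b₂) :
    ∃ R : MvPolynomial (Fin 2) F, R ≠ 0 ∧ MvPolynomial.aeval ![b₁, b₂] R = 0 := by
  classical
  by_contra hcon
  push Not at hcon
  have hind : AlgebraicIndependent F ![b₁, b₂] := by
    rw [algebraicIndependent_iff]
    intro p hp
    by_contra hp0
    exact hcon p hp0 hp
  set M := AlgebraicIndependent.matroid F K
  have hI : M.Indep (Set.range ![b₁, b₂]) := by
    rw [AlgebraicIndependent.matroid_indep_iff]; exact hind.to_subtype_range
  have hsub : Set.range ![b₁, b₂] ⊆ M.closure {a} := by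
    rintro _ ⟨i, rfl⟩
    rw [mem_closure_iff_isAlgebraic]
    fin_cases i
    · exact h₁
    · exact h₂
  have h := hI.encard_le_eRk_of_subset hsub
  rw [Matroid.eRk_closure_eq] at h
  have h2 : (Set.range ![b₁, b₂]).encard ≤ 1 :=
    h.trans ((M.eRk_le_encard _).trans (by simp))
  have hcard : (Set.range ![b₁, b₂]).encard = 2 := by
    rw [Matrix.range_cons, Matrix.range_cons, Matrix.range_empty, Set.union_empty,
      Set.union_singleton, Set.encard_pair]
    intro heq
    have := hind.injective (a₁ := 1) (a₂ := 0) (by simp [heq])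
    exact absurd this (by decide)
  rw [hcard] at h2
  norm_num at h2

/-- Transcendental elements are not loops of the matroid. [folklore] -/
theorem not_mem_closure_empty_of_transcendental {b : K} (hb : Transcendental F b) :
    b ∉ (AlgebraicIndependent.matroid F K).closure ∅ := by
  rw [mem_closure_iff_isAlgebraic]
  intro halg
  haveI : Algebra.IsAlgebraic F (Algebra.adjoin F (∅ : Set K)) := by
    rw [← Subalgebra.isAlgebraic_iff, Algebra.isAlgebraic_adjoin_iff]
    intro x hx; exact absurd hx (Set.notMem_empty x)
  exact hb (halg.restrictScalars F)

/-- **Exchange.** If `b` is algebraic over `F[a]` but transcendental over `F`, then `a` is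
algebraic over `F[b]`. [folklore] -/
theorem isAlgebraic_exchange {a b : K} (hb : IsAlgebraic (Algebra.adjoin F ({a} : Set K)) b)
    (hbt : Transcendental F b) : IsAlgebraic (Algebra.adjoin F ({b} : Set K)) a := by
  set M := AlgebraicIndependent.matroid F K
  have h : b ∈ M.closure (insert a ∅) \ M.closure ∅ := by
    refine ⟨?_, not_mem_closure_empty_of_transcendental hbt⟩
    rw [← Set.singleton_def, mem_closure_iff_isAlgebraic]; exact hb
  have h' := Matroid.closure_exchange h
  rw [← Set.singleton_def] at h'
  exact (mem_closure_iff_isAlgebraic _ _).1 h'.1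

/-- **Transitivity.** If `a` is algebraic over `F[s]` and `b` is algebraic over `F[a]`, then
`b` is algebraic over `F[s]`. [folklore] -/
theorem isAlgebraic_adjoin_of_isAlgebraic_singleton {s : Set K} {a b : K}
    (ha : IsAlgebraic (Algebra.adjoin F s) a) (hb : IsAlgebraic (Algebra.adjoin F ({a} : Set K)) b) :
    IsAlgebraic (Algebra.adjoin F s) b := by
  set M := AlgebraicIndependent.matroid F K
  rw [← mem_closure_iff_isAlgebraic] at ha hb ⊢
  have hsub : ({a} : Set K) ⊆ M.closure s := Set.singleton_subset_iff.2 ha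
  exact M.closure_subset_closure_of_subset_closure hsub hb

/-- Elements of `s` are algebraic over `F[s]`. [folklore] -/
theorem isAlgebraic_adjoin_of_mem {s : Set K} {a : K} (ha : a ∈ s) :
    IsAlgebraic (Algebra.adjoin F s) a :=
  isAlgebraic_algebraMap (⟨a, Algebra.subset_adjoin ha⟩ : Algebra.adjoin F s)

/-- **Upper bound for transcendence degrees through a closure.** If every element of an
`F`-subalgebra `A ⊆ K` is algebraic over `F[s]` for a finite set `s`, then `trdeg_F A ≤ #s`.
[folklore] -/
theorem trdeg_le_card_of_forall_isAlgebraic (A : Subalgebra F K) (s : Finset K)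
    (halg : ∀ a ∈ A, IsAlgebraic (Algebra.adjoin F (s : Set K)) a) :
    Algebra.trdeg F A ≤ (s.card : Cardinal) := by
  classical
  rw [Algebra.trdeg]
  refine ciSup_le' fun t => ?_
  rw [Cardinal.mk_le_iff_forall_finset_subset_card_le]
  intro T hT
  have hTind : AlgebraicIndependent F (fun x : (T : Set A) => (x : A)) :=
    AlgebraicIndependent.mono hT t.2
  have hKind : AlgebraicIndependent F (A.val ∘ fun x : (T : Set A) => (x : A)) :=
    hTind.map' Subtype.val_injective
  set I : Set K := Set.range (A.val ∘ fun x : (T : Set A) => (x : A)) with hI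
  have hIdef : I = ((T.image fun a : A => (a : K)) : Set K) := by
    ext u
    simp only [hI, Set.mem_range, Function.comp_apply, Finset.coe_image, Set.mem_image,
      Finset.mem_coe, Subtype.exists, exists_prop]
    constructor
    · rintro ⟨a, ha, hmem, rfl⟩; exact ⟨a, ha, hmem, rfl⟩
    · rintro ⟨a, ha, hmem, rfl⟩; exact ⟨a, ha, hmem, rfl⟩
  have hindep : (AlgebraicIndependent.matroid F K).Indep I := by
    rw [AlgebraicIndependent.matroid_indep_iff]
    exact hKind.to_subtype_range
  have hsub : I ⊆ (AlgebraicIndependent.matroid F K).closure (s : Set K) := by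
    rintro _ ⟨x, rfl⟩
    rw [mem_closure_iff_isAlgebraic]
    exact halg _ (Subtype.prop _)
  have h1 := hindep.encard_le_eRk_of_subset hsub
  rw [Matroid.eRk_closure_eq] at h1
  have h2 : I.encard ≤ (s.card : ℕ∞) :=
    h1.trans (((AlgebraicIndependent.matroid F K).eRk_le_encard _).trans
      (by rw [Set.encard_coe_eq_coe_finsetCard]))
  rw [hIdef, Set.encard_coe_eq_coe_finsetCard,
    Finset.card_image_of_injective _ Subtype.val_injective] at h2
  exact_mod_cast h2

/-- **Algebraic elements over an algebraically closed base are scalars.** [folklore] -/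
theorem mem_range_algebraMap_of_isAlgebraic [IsAlgClosed F] {a : K} (ha : IsAlgebraic F a) :
    a ∈ Set.range (algebraMap F K) := by
  have hint : IsIntegral F a := ha.isIntegral
  have hirr : Irreducible (minpoly F a) := minpoly.irreducible hint
  have hdeg : (minpoly F a).degree = 1 := IsAlgClosed.degree_eq_one_of_irreducible F hirr
  have hmonic : (minpoly F a).Monic := minpoly.monic hint
  have hnd : (minpoly F a).natDegree = 1 := Polynomial.natDegree_eq_of_degree_eq_some hdeg
  have heq : minpoly F a = Polynomial.X + Polynomial.C ((minpoly F a).coeff 0) :=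
    hmonic.eq_X_add_C hnd
  have hroot := minpoly.aeval F a
  rw [heq, map_add, Polynomial.aeval_X, Polynomial.aeval_C] at hroot
  refine ⟨-(minpoly F a).coeff 0, ?_⟩
  rw [map_neg]
  exact neg_eq_of_add_eq_zero_left hroot

/-- Contrapositive: an element outside the scalars is transcendental (algebraically closed base).
[folklore] -/
theorem transcendental_of_not_mem_range [IsAlgClosed F] {a : K}
    (ha : a ∉ Set.range (algebraMap F K)) : Transcendental F a :=
  fun h => ha (mem_range_algebraMap_of_isAlgebraic h)

end Literature.FieldTheory.TranscendenceDegree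

end
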